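import Summits.QuantumFields.YangMills.Theorems.BalabanUVNodesN12AtRecord13Prop1KnitThm1AtZSeq
import Summits.QuantumFields.YangMills.Theorems.BalabanUVNodesN07Thm1Top7FromProp8
import Literature.MathematicalPhysics.QuantumFieldTheory.Balaban1983to89.B15Prop1Thm1GeneralFormShapes
import Literature.MathematicalPhysics.QuantumFieldTheory.Balaban1983to89.Node00.Record12BgRowCoClassCPM
import Summits.QuantumFields.YangMills.Theorems.BalabanUVNodesK0VariationalThm1ScaledCorner

/-!
# BalabanUVNodes ∕ N12 — THE [15]-THEOREM-1 INPUT OF N12's PROPOSITION-1 ROW IS K0⁷'s (8): N12's row below the torus at the live re-pin, `N = 2`, at print's (1.74)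
# object, with the Proposition-1 display fed by dag-n12-c's torus-class endpoint and ITS [15] letter fed by NODE 00's named fact `VariationalThm1RegSepCoP7M F 2 B₃ a₀ a₁'`
# (ONE hypothesis for all runs and instances) — and, at the collared K0⁷ witness, by plan g76 V15 STUB 1's letters BY NAME (Track A, DAG node N12 = [B15, Balaban1989LargeFieldI]
# CMP **122** (1989) 175–202; cluster K1 — K1⁷ `StabilityBAtRecordR13SepCoPH` = stmt-QuantumFields-20542, helper; seat `pub-ymgap-dag-n12-d` g14 (R134 s2 «knit at the record»),
# 2026-08-27; count-neutral, CONDITIONAL, NOT a discharge)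

HONEST FRAMING.  Count-neutral kernel bookkeeping BY NAME over landed modules: dag-n12-c g15 `B15Prop1Thm1GeneralFormShapes` (★★★
`exists_domain_prop1Printed_lfVarOn_std_su2_box_intrinsic_analytic_atZSeqCoPRecord_ofThm1TorusClass`, §1 `exists_seq_reindex_Ω` ∕ `seqSeparated_iff_of_Ω_eq`), NODE 00's
`Node00.VariationalThm1RegSepCoP7M` (`Record12BgRowCoClassCPM`, a `Prop` with parameters, NEVER asserted), dag-n07-e's `variationalThm1RegSepCoP7M_of_prop8TopStep`, this seat's 12E
`…N12AtRecord13OfResiduals` row and 12Q⁗'s statement shape, dag-n21-c FILE A's collared witness.  THE ONE OBSERVATION (§0): NODE 00's (8) quantifies over every numerics `ν`, cube letter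
`M`, coupling history `g`, torus `K` and length `k`, its (2.18) index class `DOfRecord F ν M g K j` being the unions of `Lʲ·M·R_j(g_j)`-cubes; at the DEGENERATE HISTORY `(M, g) := (ν.M₁, 1)`
one has `R_j(1) = 1` ((2.5): `(log 1⁻²)^r = 0^r ≤ L⁰` — dag-n21-c's `RkOfRecord_at_one`, the degenerate-history device of its corner module `…K0VariationalThm1ScaledCorner`) and the class IS dag-n12-c's torus-native class of `LʲM₁`-cube unions (shape (C)); dag-n12-c's `Ω`-re-indexing moves every
torus-class index into it, so (8) IMPLIES the torus-class [15] letter `h15T` at every `(ν, Kt)` (dag-n12-c kernel-checked this junction against its text before this file was typed —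
bus l.22315).  CONSEQUENCE: the [15] input of N12's Proposition-1 junction ([IV] p.193 ll.14–20 «… by Theorem 1 [15]») is no separate display — it is the K0 road's own token (8),
and at the collared witness it is plan g76 V15 stub 1 `stub_prop8StepCoP13`'s letters (the witness's `(B₃, a₀)` ARE the [15] constants; `ν.εreg = a₀` by `rfl`).  WHAT STAYS A LETTER
per instance: (J1) `hGj`, (L2) `hlead` + `hsm` ∕ `hγle` (NODE 00's ∕ [LF-II] pp.357–359), `hcJ'`, (Gᵃ) `hZblk`, `hM2` (generic `Θ`) + `hdiv`, the box inclusion `hZ1`, `hk0` ∕ `hk`, box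
data; K0b's residuals `hres` (generic `Θ`); N12's per-run displays below the torus ((1.100) pin, live-mass — NODE 00 —, (1.80), (1.89) — dag-n12-e's pins).  (8) ∕ Prop. 8's step
are HYPOTHESES (K0⁷'s stubs), never asserted; using (8) at `g = 1` is an instance of its typed generality (print's Thm 1 [15] is uniform in the admissible sequence; [III] (2.1)'s
`R_j`-scaling is a choice of class), flagged here, not hidden.  Nothing of Bałaban's is asserted; N12 is NOT discharged; no node is discharged; K0⁷ ∕ K1⁷ NOT closed; counts unmoved
(discharged 5∕27 · Track A 5∕28).  TYPING NOTE: as in 12Q‴∕12Q⁗, hypothesis bodies at the AMBIENT bond decidability, dag-n12-c's endpoint taking `[hdec]` with `hcl := Subsingleton.elim _ _`;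
`IsBlockUnion` ∕ `blockIter` ∕ `side` written `B14.…` (NODE 00 homonyms).  ONE finite four-torus programme at fixed `ε = L^{-K}` — nothing continuum ∕ ℝ⁴ ∕ OS ∕ mass gap ∕ Clay.
-/

noncomputable section
open MeasureTheory Set Finset Metric
open scoped Matrix.Norms.L2Operator BigOperators Matrix RealInnerProductSpace Real InnerProductSpace

namespace Summit.QuantumFields.YangMills.BalabanUVNodes.N12AtRecord13Prop1KnitThm1OfRecord

open Literature.MathematicalPhysics.QuantumFieldTheory.Balaban1983to89
open Literature.MathematicalPhysics.QuantumFieldTheory.Balaban1983to89.T4Continuum (T4Family)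
open Literature.MathematicalPhysics.QuantumFieldTheory.Balaban1983to89.DagBinding
open Literature.MathematicalPhysics.QuantumFieldTheory.Balaban1983to89.Node00
open B15Claim189Assembly (new189 chiPP dom)
open B15 (Prop1Printed Ineq180)
open B15.BasicStep (Claim189)
open B8Eq17ClassAkV1 (plaqsOf)
open B15RPrime1100OfRep (rPrimeDataOfSel)
open Summit.QuantumFields.YangMills.BalabanUVNodes.N12AtRecord13OfResiduals (b15Leaf_WOfRecord₁₃_liveRepin₁₃_of_massLive_of_hasResiduals)
-- dag-n12-c's vocabulary (as opened in `B15Prop1IntrinsicAnalyticAtRecord`)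
open B15DeterminingSets (pts DetBackground genSet IsMinimizer MSField)
open B15Prop1Carrier (lfVarOn InstOn InstOn.std plaqsInside)
open B15Prop1Thm1GeneralFormShapes (exists_seq_reindex_Ω seqSeparated_iff_of_Ω_eq
  exists_domain_prop1Printed_lfVarOn_std_su2_box_intrinsic_analytic_atZSeqCoPRecord_ofThm1TorusClass)
open Summit.QuantumFields.YangMills.BalabanUVNodes.N07Thm1Top7FromProp8 (variationalThm1RegSepCoP7M_of_prop8TopStep)
open Summit.QuantumFields.YangMills.Theorems.K0VariationalThm1ScaledCorner (RkOfRecord_at_one)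
open B15Prop1GradientFromNearValueAtCoPRecord (far_letter_of_box)
open B15Prop1AnalyticExtClause (cplxVec anExt)
open B15Prop1ChartCalculusSU2 (E3)
open T4CubeChartGnomonic (SU2)
open B15Prop1ChartSU2 (su2Chart)
open B15Prop1SliceCoordinates (GaugeSlice ιA)
open B15Prop1SliceTaylorCalculus (rGrad sliceFn)
open T4AxialGaugeSmallField (castSite boxPlaqs)
open B6BondElimination (unitVec)
open B16Eq18Proof (box)
open B15Extension193 (extend)
open B15ShellGauge193 (shellGauge)
open B5Bounds167Lattice (formDk ofRealCfg)
open B15Sect1Instances (fun177std)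
open B14.Eq213DetSet (Bj maxDomT)
open B16Sect1Backgrounds (expMul)
open GaugeField (gaugeAct)

variable {F : T4Family}

/-! ## §0 THE JUNCTION: NODE 00's (8) at the degenerate history `(M, g) := (ν.M₁, 1)` IS dag-n12-c's torus-class [15] letter `h15T` -/

section Junction

/-- **NODE 00's CLASS OF RECORD `𝐃_j` AT `(M, g) := (ν.M₁, 1)` IS THE TORUS-NATIVE CLASS OF `LʲM₁`-CUBE UNIONS** (`R_j(1) = 1` by dag-n21-c's `RkOfRecord_at_one` — (2.5): `(log 1⁻²)^r = 0^r ≤ L⁰` —, so `dCubeSide L M₁ (R_j 1) j = Lʲ·M₁·1 = side L M₁ j`):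
dag-n12-c's shape (C) (`B15Prop1Thm1GeneralFormShapes`, the house shape of `DOfRecord`). [cite: Balaban1988Convergent, (2.1) p.254, (2.13) p.256; Balaban1985RegularSpaces, (1.3)–(1.6) p.77 (bookkeeping)] -/
theorem DOfRecord_self_one (F : T4Family) (ν : Stage7Numerics) (K : ℕ) :
    DOfRecord F ν ν.M₁ (fun _ => (1 : ℝ)) K = fun n => Node00.unionsOfCubes (F.P K) (B14.Eq213MaximalDomains.side (F.P K).L ν.M₁ n) := by
  funext n
  -- `R_j(1) = 1`: dag-n21-c's `RkOfRecord_at_one` ((2.5) at `g = 1`: `(log 1⁻²)^r = 0^r ≤ L⁰`; the corner module's degenerate-history device)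
  simp only [DOfRecord, RkOfRecord_at_one, dCubeSide, B14.Eq213MaximalDomains.side, Nat.mul_one]

/-- **★ THE JUNCTION — NODE 00's NAMED FACT (8) `VariationalThm1RegSepCoP7M F 2 B₃ a₀ a₁'` ([15] Thm 1 (R) over class (6) on the support of record, for EVERY numerics,
cube letter, coupling history, torus and length) READ AT `(ν, M := ν.M₁, g := 1, K := Kt)` IS dag-n12-c's torus-class letter `h15T` at `(ν, Kt)`** (the shape-(C) text of
`B15Prop1Thm1GeneralFormShapes.…_ofThm1TorusClass`, VERBATIM; its two guards `k' ≤ m + K`, `LᵏʹM₁ ∣ sitesPerDir 0` idle): by `DOfRecord_self_one` the (2.18) index class of record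
at that history IS the class of `LʲM₁`-cube unions, and dag-n12-c's `exists_seq_reindex_Ω` ∕ `seqSeparated_iff_of_Ω_eq` move any torus-class index into it along its `Ω`-sequence
(every reader of the [15] body reads `s.Ω` only).  So the [15] input of N12's Proposition-1 row is NOT a separate letter: it is K0⁷'s (8).  Pure bookkeeping; (8) stays a HYPOTHESIS.
[cite: Balaban1985Variational, (1) p.277, Thm 1 (2),(3),(5),(6),(7)–(8) pp.278–279; Balaban1988Convergent, (2.1) p.254, (2.5) p.255, (2.12)–(2.13) p.256, (2.18) p.257; Balaban1985RegularSpaces, (1.3)–(1.9) p.77; Balaban1989LargeFieldI, (1.74) p.192, p.193 ll.14–20 (bookkeeping)] -/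
theorem thm1TorusClass_of_variationalThm1RegSepCoP7M (ν : Stage7Numerics) (Kt : ℕ) {B₃ a₀ a₁' : ℝ} (h15 : VariationalThm1RegSepCoP7M F 2 B₃ a₀ a₁') :
    ∀ (k' : ℕ), k' ≤ (F.P Kt).m + (F.P Kt).K → B14.Eq213MaximalDomains.side (F.P Kt).L ν.M₁ k' ∣ (F.P Kt).sitesPerDir 0 →
      ∀ (s : B14.Eq218Concrete.Seq (fun n : ℕ => Node00.unionsOfCubes (F.P Kt) (B14.Eq213MaximalDomains.side (F.P Kt).L ν.M₁ n)) k'),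
      Node00.Sect2.SeqSeparated ν.M₁ s → 0 < ν.M₁ →
      ∀ (ε₀ : ℝ) (δ : ℕ → ℝ), (∀ j, j ≤ k' → 0 < δ j ∧ δ j ≤ a₁' ∧ B₃ * δ j ≤ ε₀) → (∀ j, j < k' → δ j ≤ 2 * δ (j + 1)) →
      (∀ j, j < k' → δ (j + 1) ≤ 2 * δ j) → ε₀ ≤ a₀ →
      ∀ W : MSField (F.P Kt) SU2,
        Node00.Sect2.DataSmall7PTop (Node00.avOfRecord F 2 Kt) s.Ω (Node00.suppDomOfRecord F ν Kt s.Ω) k' δ W →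
        ∀ U₀ : GaugeField (F.P Kt) 0 SU2, IsMinimizer (Node00.avOfRecord F 2 Kt)
            {U | (∀ j, j ≤ k' → PlaqSmallOn (Node00.Sect2.omegaPlaqsTop s.Ω (Node00.suppDomOfRecord F ν Kt s.Ω) j)
                (ε₀ * (F.P Kt).eta j ^ 2) U) ∧
              Node00.Sect2.CoDivClassOnTop s.Ω (Node00.suppDomOfRecord F ν Kt s.Ω) k' ε₀ U}
            (genSet s.Ω k') W U₀ →
          (∀ j, j ≤ k' → PlaqSmallOn (Node00.Sect2.omegaPlaqsTop s.Ω (Node00.suppDomOfRecord F ν Kt s.Ω) j)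
              (B₃ * δ j * (F.P Kt).eta j ^ 2) U₀) ∧
            ∀ j, j ≤ k' → Node00.Sect2.CoDivSmallOn (Node00.Sect2.omegaBondsTop s.Ω (Node00.suppDomOfRecord F ν Kt s.Ω) j)
              (B₃ * δ j * (F.P Kt).eta j ^ 3) U₀ := by
  -- proof recipe kernel-checked by dag-n12-c against its `h15T` text (junction_check.scratch, 2026-08-27)
  intro k' _ _ s hsep
  obtain ⟨s', hΩ, -⟩ := exists_seq_reindex_Ω s (DOfRecord F ν ν.M₁ (fun _ => (1 : ℝ)) Kt) fun j h1 hj => by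
    rw [DOfRecord_self_one]; exact s.chain.memΩ j h1 hj
  have h := h15 ν ν.M₁ (fun _ => (1 : ℝ)) Kt k' s' ((seqSeparated_iff_of_Ω_eq ν.M₁ hΩ).2 hsep)
  rw [hΩ] at h
  exact h

/-- **★ THE SAME FROM plan g76 V15 STUB 1's LETTERS** ([15] Prop. 8's top step at NODE 00's objects, `0 < B₃`): dag-n07-e's bridge `variationalThm1RegSepCoP7M_of_prop8TopStep` ∘ ★.
CONDITIONAL on the displayed Prop. 8 step. [cite: Balaban1985Variational, Thm 1 (8) p.279, Prop. 8 p.304, Sect. F pp.300–305 (bookkeeping)] -/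
theorem thm1TorusClass_of_prop8TopStep (ν : Stage7Numerics) (Kt : ℕ) {B₃ a₀ a₁' : ℝ} (hB : 0 < B₃)
    (h8 : Prop8RegSepTopStep F 2 (fun ν K Ω => suppDomOfRecord F ν K Ω) B₃ a₀ a₁') :
    ∀ (k' : ℕ), k' ≤ (F.P Kt).m + (F.P Kt).K → B14.Eq213MaximalDomains.side (F.P Kt).L ν.M₁ k' ∣ (F.P Kt).sitesPerDir 0 →
      ∀ (s : B14.Eq218Concrete.Seq (fun n : ℕ => Node00.unionsOfCubes (F.P Kt) (B14.Eq213MaximalDomains.side (F.P Kt).L ν.M₁ n)) k'),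
      Node00.Sect2.SeqSeparated ν.M₁ s → 0 < ν.M₁ →
      ∀ (ε₀ : ℝ) (δ : ℕ → ℝ), (∀ j, j ≤ k' → 0 < δ j ∧ δ j ≤ a₁' ∧ B₃ * δ j ≤ ε₀) → (∀ j, j < k' → δ j ≤ 2 * δ (j + 1)) →
      (∀ j, j < k' → δ (j + 1) ≤ 2 * δ j) → ε₀ ≤ a₀ →
      ∀ W : MSField (F.P Kt) SU2,
        Node00.Sect2.DataSmall7PTop (Node00.avOfRecord F 2 Kt) s.Ω (Node00.suppDomOfRecord F ν Kt s.Ω) k' δ W →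
        ∀ U₀ : GaugeField (F.P Kt) 0 SU2, IsMinimizer (Node00.avOfRecord F 2 Kt)
            {U | (∀ j, j ≤ k' → PlaqSmallOn (Node00.Sect2.omegaPlaqsTop s.Ω (Node00.suppDomOfRecord F ν Kt s.Ω) j)
                (ε₀ * (F.P Kt).eta j ^ 2) U) ∧
              Node00.Sect2.CoDivClassOnTop s.Ω (Node00.suppDomOfRecord F ν Kt s.Ω) k' ε₀ U}
            (genSet s.Ω k') W U₀ →
          (∀ j, j ≤ k' → PlaqSmallOn (Node00.Sect2.omegaPlaqsTop s.Ω (Node00.suppDomOfRecord F ν Kt s.Ω) j)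
              (B₃ * δ j * (F.P Kt).eta j ^ 2) U₀) ∧
            ∀ j, j ≤ k' → Node00.Sect2.CoDivSmallOn (Node00.Sect2.omegaBondsTop s.Ω (Node00.suppDomOfRecord F ν Kt s.Ω) j)
              (B₃ * δ j * (F.P Kt).eta j ^ 3) U₀ :=
  thm1TorusClass_of_variationalThm1RegSepCoP7M ν Kt (variationalThm1RegSepCoP7M_of_prop8TopStep hB h8)

end Junction

/-! ## §1 `N = 2`, generic `Θ` carrying node00-def-K0b's residuals: 12Q⁗ §1b with the [15] input = NODE 00's (8) -/

section RecordAtZSeq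
variable (Θ : Stage13Params F 2) (lam : ResidW F 2)

/-- **★★★★ N12's ROW BELOW THE TORUS AT THE LIVE RE-PIN, `N = 2`, AT PRINT's (1.74) OBJECT — THE [15] INPUT OF PROPOSITION 1 IS K0⁷'s (8), ONE HYPOTHESIS FOR ALL RUNS AND INSTANCES** —
12Q⁗ §1b (`…_of_thm1AtZSeqLetters_atZSeqCoPRecord_geom`) with its per-run, per-instance letter `h15Z` ([15] Thm 1 (R) at `Z`'s own sequence) REPLACED by NODE 00's named fact
`h15 : VariationalThm1RegSepCoP7M F 2 B₃ a₀ a₁'` — the SAME token the K0 road displays (plan g76 V15 stub 1's consequence by dag-n07-e's `variationalThm1RegSepCoP7M_of_prop8TopStep`; 12Z ∕ 12Z′'s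
`h15`): per run, §0's junction reads (8) at the degenerate history `(M, g) := (Θ.ν.M₁, 1)` as dag-n12-c's torus-class letter `h15T` at `(Θ.ν, P.K)`, and dag-n12-c g15's
`…_atZSeqCoPRecord_ofThm1TorusClass` serves Proposition 1 at print's (1.74) object from it with (J1) ∕ (L2) ∕ geometry ∕ bookkeeping.  The bookkeeping's [15] constants are now ONE triple
`(B₃, a₀, a₁')` = (8)'s (`heRa`, `ha₀ : Θ.ν.εreg ≤ a₀`, `hcA` read them); everything else VERBATIM 12Q⁗ §1b (per instance: the background is NODE 00's v1.5 constructor at `Z`'s own maximal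
sequence, the pinned LF layer and the conclusion unchanged).  WHAT STAYS A LETTER: (J1) `hGj`, (L2) `hlead` + `hsm` ∕ `hγle`, `hcJ'`, (Gᵃ) `hZblk`, `hM2` + `hdiv`, the box inclusion `hZ1`, `hk0` ∕ `hk`,
box data; K0b's residuals `hres`; N12's per-run displays below the torus ((1.100) pin, live-mass, (1.80), (1.89)); AND (8) itself — a HYPOTHESIS (K0⁷'s), never asserted.  Count-neutral;
NOT a discharge of N12. [cite: Balaban1989LargeFieldI, (0.2)–(0.6) p.176, (1.74) p.192, p.193 ll.14–20, Prop. 1 (1.77)–(1.78) p.194, (1.80) p.195, (1.89) p.198, (1.99)–(1.102) pp.200–201; Balaban1989LargeFieldII, (1.7)–(1.9) p.358, (1.11)–(1.13) p.359; Balaban1988Convergent, (2.1) p.254, (2.5) p.255, (2.12)–(2.13) pp.256–257, (2.16)–(2.18) p.257, (3.16) p.268; Balaban1985Variational, (1) p.277, (2),(5),(6),(7) p.278, Thm 1 (8) p.279, Prop. 9 p.309; Balaban1985RegularSpaces, (1.3)–(1.6) p.77 (bookkeeping)] -/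
theorem exists_pinLF_b15Leaf_WOfRecord₁₃_liveRepin₁₃_of_massLive_of_hasResiduals_of_variationalThm1RegSepCoP7M_atZSeqCoPRecord_geom (hres : Θ.HasResidualsOfRecord F 2)
    -- N12's displays at the letters `kSel ∕ D189 ∕ D1100` of `λ`, run by run, BELOW THE TORUS
    (hpin : ∀ P : B12.RunParams, lam.kSel P < P.K → lam.D1100 P
      = rPrimeDataOfSel (reprTOfRecord₁₃ F 2 (Θ.liveRepin₁₃ F 2) P (lam.kSel P))
          ((Θ.liveRepin₁₃ F 2).ppSel P (gOfRecord₁₃ F 2 (Θ.liveRepin₁₃ F 2) P) (lam.kSel P + 1))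
          (fibOfSeq F (Θ.liveRepin₁₃ F 2).ν (Θ.liveRepin₁₃ F 2).τ9 P (gOfRecord₁₃ F 2 (Θ.liveRepin₁₃ F 2) P) (lam.kSel P + 1)))
    (hmassLive : ∀ P : B12.RunParams, lam.kSel P < P.K → ∀ s, LiveSeq F 2 Θ.ν Θ.τ9 P (gOfRecord₁₃ F 2 (Θ.liveRepin₁₃ F 2) P) (lam.kSel P + 1)
        (slotsTOfRecord F 2 Θ.ν Θ.τ9 (EOfRecord₁₃ F 2 (Θ.liveRepin₁₃ F 2)) (wOfRecord₉ F 2 (Θ.liveRepin₁₃ F 2).toStage9Params)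
          (Θ.liveRepin₁₃ F 2).ppSel P (gOfRecord₁₃ F 2 (Θ.liveRepin₁₃ F 2) P) (lam.kSel P + 1)) s →
      0 < ∫ V, rterm (reprTOfRecord₁₃ F 2 (Θ.liveRepin₁₃ F 2) P (lam.kSel P)) s V ∂(fieldMeasure (F.P P.K) (lam.kSel P + 1) (SU 2)))
    (h180 : ∀ P : B12.RunParams, lam.kSel P < P.K → ∀ U, new189 (lam.D189 P) U → ∀ i, (lam.D189 P).h ≤ i → i ≤ (lam.D189 P).k →
      ∀ q ∈ plaqsOf (dom (lam.D189 P) i),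
        Ineq180 ((lam.D189 P).dev0 U q) ((lam.D189 P).ε (lam.D189 P).k) (lam.D189 P).η (lam.D189 P).B₃ (lam.D189 P).B₅ (lam.D189 P).M (lam.D189 P).δ
          ((lam.D189 P).dist q) (lam.D189 P).O1)
    (h189 : ∀ P : B12.RunParams, lam.kSel P < P.K → Claim189 (new189 (lam.D189 P)) (chiPP (lam.D189 P)))
    -- dag-n12-c's Proposition-1 instance data ON THE RUN's LATTICE `F.P P.K`, per run `P` and instance `i : ι P` (structural ∕ constants, exactly as in its endpoint of record)
    (hd3 : ∀ P : B12.RunParams, 3 ≤ (F.P P.K).d) (h0 : ∀ P : B12.RunParams, 0 < (F.P P.K).d) (ι : B12.RunParams → Type)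
    -- NO background letters: per instance the class is that of `Z P i`'s OWN maximal sequence `maxDomT Θ.ν.M₁ (Z P i)` up to scale `k P i` (dag-n12-c LOCATED-CLASS)
    (Z Λ : ∀ P : B12.RunParams, ι P → Set (Site (F.P P.K) 0))
    (k : ∀ P : B12.RunParams, ι P → ℕ) (M : ∀ P : B12.RunParams, ι P → ℝ) (hk0 : ∀ P i, 0 < k P i) (hk : ∀ P i, k P i ≤ (F.P P.K).m + (F.P P.K).K)
    (eR : ∀ P : B12.RunParams, ι P → ℝ) (heR : ∀ P i, 0 < eR P i)
    (T : ∀ (P : B12.RunParams) (i : ι P), Finset (PBond (F.P P.K) (k P i)))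
    (lo hi : ∀ P : B12.RunParams, ι P → Fin (F.P P.K).d → ℤ) (n : ∀ P : B12.RunParams, ι P → ℕ) (hn : ∀ P i κ, hi P i κ ≤ lo P i κ + n P i)
    (hN : ∀ P i, n P i + 2 < (F.P P.K).sitesPerDir (k P i))
    (hbox : ∀ P i, pts (k P i) (Λ P i) = (castSite '' Set.Icc (lo P i) (hi P i) : Set (Site (F.P P.K) (k P i))))
    (hZ : ∀ P i, (boxPlaqs (lo P i - 1) (hi P i + 1) : Set (Plaq (F.P P.K) (k P i))) ⊆ plaqsInside (pts (k P i) (Z P i)))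
    (hTG0 : ∀ P i, T P i = (box (fun κ => (hi P i κ - lo P i κ + 1).toNat) (lo P i)).image fun x =>
      (⟨castSite (x - unitVec ⟨0, h0 P⟩), ⟨0, h0 P⟩⟩ : PBond (F.P P.K) (k P i)))
    (hN5 : ∀ P i κ, ((hi P i κ - lo P i κ + 1).toNat : ℤ) + 5 < (F.P P.K).sitesPerDir (k P i))
    (Kb : ∀ P : B12.RunParams, ι P → ℕ) (hK1 : ∀ P i, 1 ≤ Kb P i) (hKn : ∀ P i κ, (hi P i κ - lo P i κ + 1).toNat ≤ Kb P i)
    (ext : ∀ (P : B12.RunParams) (i : ι P), GaugeField (F.P P.K) (k P i) SU2 → GaugeField (F.P P.K) (k P i) SU2)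
    (hext : ∀ P i Vk, ext P i Vk = extend (pts (k P i) (Λ P i)) (shellGauge Vk (lo P i) (hi P i)) Vk)
    (hlohi : ∀ P i, lo P i ≤ hi P i)
    {γ cJ bx : B12.RunParams → ℝ} (hγ : ∀ P, 0 < γ P) (hcJ : ∀ P, 0 ≤ cJ P) (hbx : ∀ P, 0 ≤ bx P)
    (hbxM : ∀ P i, 12 * ((F.P P.K).d : ℝ) * ((n P i : ℝ) + 2) ^ 2 ≤ bx P * (M P i) ^ 2)
    {Cerr R 𝓐 : ∀ P : B12.RunParams, ι P → ℝ} (hM : ∀ P i, 1 ≤ M P i) (hR : ∀ P i, 0 < R P i) (h𝓐 : ∀ P i, 0 ≤ 𝓐 P i)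
    (n' : ∀ P : B12.RunParams, ι P → ℕ) (hn' : ∀ P i, 1 ≤ n' P i)
    -- (J1) the JOINT holomorphic extension of print's function in the datum perturbation and the field
    (hGj : ∀ P i Vk, PlaqSmallOn (plaqsInside (pts (k P i) (Z P i ∩ (Λ P i)ᶜ))) (eR P i) Vk →
      ∃ 𝒢 : VecField (F.P P.K) (k P i) (EuclideanSpace ℂ (Fin 3)) × VecField (F.P P.K) (k P i) (EuclideanSpace ℂ (Fin 3)) → ℂ,
        DifferentiableOn ℂ 𝒢 (ball 0 (R P i)) ∧
        (∀ z ∈ ball (0 : VecField (F.P P.K) (k P i) (EuclideanSpace ℂ (Fin 3)) × VecField (F.P P.K) (k P i) (EuclideanSpace ℂ (Fin 3))) (R P i), ‖𝒢 z‖ ≤ 𝓐 P i) ∧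
        ∀ p B' : VecField (F.P P.K) (k P i) E3, ‖p‖ < R P i → ‖B'‖ < R P i →
          𝒢 (cplxVec p, cplxVec B') =
            ((fun177std (bgMSCoPOfRecord F 2 Θ.ν P.K (k P i) (maxDomT Θ.ν.M₁ (Z P i))) Θ.ν.M₁ (Z P i) (k P i) (expMul su2Chart B' (ext P i (expMul su2Chart p Vk))) : ℝ) : ℂ))
    -- (L2) (1.7)–(1.9) p.358 for the Hessian of the slice function at `0`
    (hlead : ∀ P i Vk, PlaqSmallOn (plaqsInside (pts (k P i) (Z P i ∩ (Λ P i)ᶜ))) (eR P i) Vk →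
      ∀ X : GaugeSlice (pts (k P i) (Λ P i)) (T P i) E3,
      |⟪X, (fderiv ℝ (rGrad (pts (k P i) (Λ P i)) (T P i)
              (sliceFn (pts (k P i) (Λ P i)) (T P i) (fun177std (bgMSCoPOfRecord F 2 Θ.ν P.K (k P i) (maxDomT Θ.ν.M₁ (Z P i))) Θ.ν.M₁ (Z P i) (k P i)) (ext P i Vk))) 0) X⟫ -
          ∑ a : Fin 3, formDk (n' P i) (fun _ : Fin (F.P P.K).d => (F.P P.K).sitesPerDir (k P i))
            (ofRealCfg (fun _ : Fin (F.P P.K).d => (F.P P.K).sitesPerDir (k P i)) fun j =>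
              ιA (pts (k P i) (Λ P i)) (T P i) X ⟨j.1, j.2⟩ a)| ≤ Cerr P i * ‖X‖ ^ 2)
    (hsm : ∀ P i, Cerr P i ≤ (4 / Real.pi ^ 2) ^ ((F.P P.K).d + 2) / (2 * (3 * (Kb P i : ℝ) ^ 2 + 2 * (Kb P i : ℝ) ^ 4)))
    (hγle : ∀ P i, γ P / (M P i) ^ 5 ≤ (4 / Real.pi ^ 2) ^ ((F.P P.K).d + 2) / (2 * (3 * (Kb P i : ℝ) ^ 2 + 2 * (Kb P i : ℝ) ^ 4)))
    -- the geometric letter: every fine site whose k-block label lies in the box `[lo − 1, hi + 1]` lies in `Ω₁(Z)` (print: `Λ` deep inside `Z`); dag-n12-c's `far_letter_of_box` turns it into the bond letter `hfar`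
    (hZ1 : ∀ P i (y : Site (F.P P.K) 0), B14.Eq22Determines.blockIter (k P i) y ∈ (castSite '' Set.Icc (lo P i - 1) (hi P i + 1) : Set (Site (F.P P.K) (k P i))) → y ∈ maxDomT Θ.ν.M₁ (Z P i) 1)
    -- (Gᵃ) `Z` a union of `k`-blocks (print's `Z` is a union of `M`-cubes of `T₁^{(k)}`)
    (hZblk : ∀ P i, B14.Eq22Determines.IsBlockUnion (k P i) (Z P i))
    -- (Gᵇ) DISCHARGED (dag-n12-c §8): print's `M₁ ≥ 2` and, per instance, the torus divisibility `L^{k}·M₁ ∣ 2L^{m+K}` of the `LʲM₁`-cube partitions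
    (hM2 : 2 ≤ Θ.ν.M₁) (hdiv : ∀ P i, B14.Eq213MaximalDomains.side (F.P P.K).L Θ.ν.M₁ (k P i) ∣ (F.P P.K).sitesPerDir 0)
    -- bookkeeping constants: `c_E`, `c_A` per run; `B₃`, `a₀`, `a₁'` = THE [15] THEOREM-1 CONSTANTS OF (8) (one triple for all runs and instances)
    {cE cA : B12.RunParams → ℝ} {B₃ a₀ a₁' : ℝ} (hcE0 : ∀ P, 0 ≤ cE P) (hcE : ∀ P i, 12 * ((F.P P.K).d : ℝ) * ((n P i : ℝ) + 2) ^ 2 ≤ cE P) (hB₃ : 0 ≤ B₃)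
    (heRa : ∀ P i, (cE P + 1) * eR P i ≤ a₁' ∧ B₃ * ((cE P + 1) * eR P i) ≤ Θ.ν.εreg) (ha₀ : Θ.ν.εreg ≤ a₀)
    (hcA : ∀ P, 1 / 2 * (B₃ * (cE P + 1) * (F.P P.K).eta 1 ^ 2) ^ 2 * (Fintype.card (Plaq (F.P P.K) 0) : ℝ) ≤ cA P)
    -- [15] THEOREM 1 (R) = NODE 00's NAMED FACT (8) `VariationalThm1RegSepCoP7M` — K0⁷'s letter (plan g76 V15 stub 1's consequence by dag-n07-e's bridge) — ONE hypothesis for all runs and instances;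
    -- §0 reads it at the degenerate history `(M, g) := (ν.M₁, 1)` as dag-n12-c's torus-class letter `h15T` at every `(Θ.ν, P.K)`
    (h15 : VariationalThm1RegSepCoP7M F 2 B₃ a₀ a₁')
    (hcJ' : ∀ P i, 2 * cA P * eR P i / R P i + 4 * 𝓐 P i / (R P i * eR P i) ≤ cJ P) :
    ∃ areg : ∀ P : B12.RunParams, ι P → ℝ, (∀ P i, 0 < areg P i) ∧
      ∀ P : B12.RunParams, lam.kSel P < P.K →
        B15Leaf (WOfRecord₁₃ F 2 (Θ.liveRepin₁₃ F 2)
          { lam with LF := fun P => lfVarOn su2Chart fun i => InstOn.std (bgMSCoPOfRecord F 2 Θ.ν P.K (k P i) (maxDomT Θ.ν.M₁ (Z P i))) Θ.ν.M₁ (Z P i) (Λ P i) (k P i) (M P i) (areg P i)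
                            (anExt (pts (k P i) (Λ P i)) (T P i) (fun177std (bgMSCoPOfRecord F 2 Θ.ν P.K (k P i) (maxDomT Θ.ν.M₁ (Z P i))) Θ.ν.M₁ (Z P i) (k P i)) (ext P i)
                              (min (1 / 2) (min (R P i / 8) (γ P / (M P i) ^ 5 * (R P i / 2) ^ 2 / (48 * (4 * 𝓐 P i / R P i + 1)))))) } P) := by
  choose areg ha hP using fun P : B12.RunParams =>
    exists_domain_prop1Printed_lfVarOn_std_su2_box_intrinsic_analytic_atZSeqCoPRecord_ofThm1TorusClass (F := F) Θ.ν P.K (hd3 P) (h0 P) (hcl := Subsingleton.elim _ _)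
      (Z := Z P) (Λ := Λ P) (k := k P) (M := M P) (hk0 := hk0 P) (hk := hk P) (eR := eR P) (heR := heR P) (T := T P) (lo := lo P) (hi := hi P) (n := n P) (hn := hn P)
      (hN := hN P) (hbox := hbox P) (hZ := hZ P) (hTG0 := hTG0 P) (hN5 := hN5 P) (K := Kb P) (hK1 := hK1 P) (hKn := hKn P) (ext := ext P) (hext := hext P) (hlohi := hlohi P)
      (hγ := hγ P) (hcJ := hcJ P) (hbx := hbx P) (hbxM := hbxM P) (hM := hM P) (hR := hR P) (h𝓐 := h𝓐 P) (n' := n' P) (hn' := hn' P) (hGj := hGj P) (hlead := hlead P)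
      (hsm := hsm P) (hγle := hγle P) (hfar := fun i b hb => far_letter_of_box (hbox P i) (hZ1 P i) b hb) (hZblk := hZblk P) (hM2 := hM2) (hdiv := hdiv P)
      (hcE0 := hcE0 P) (hcE := hcE P) (hB₃ := hB₃) (heRa := heRa P) (ha₀ := ha₀) (hcA := hcA P)
      (h15T := thm1TorusClass_of_variationalThm1RegSepCoP7M Θ.ν P.K h15) (hcJ' := hcJ' P)
  refine ⟨areg, ha, fun P hkP => ?_⟩
  apply b15Leaf_WOfRecord₁₃_liveRepin₁₃_of_massLive_of_hasResiduals Θ _ hres (P := P)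
  · exact hkP
  · exact hpin P hkP
  · exact hmassLive P hkP
  · exact hP P
  · exact h180 P hkP
  · exact h189 P hkP
end RecordAtZSeq

/-! ## §2 At the collared K0⁷ witness `θ₁₅ᶜᶜᴹ(jM)(B₃, B₃', a₀, a₁c)`: the [15] input from plan g76 V15 stub 1's letters (Prop. 8's top step) -/

section AtThm1CCM
variable (jM : ℕ) (ε₀ ε₂₉ B₃ B₃' a₀ a₁' a₁c : ℝ) (lam : ResidW F 2)

/-- **★★★★ THE SAME ROW AT THE COLLARED K0⁷ WITNESS `θ₁₅ᶜᶜᴹ(jM)(B₃, B₃', a₀, a₁c)` WITH THE [15] INPUT DISCHARGED FROM plan g76 V15 STUB 1's LETTERS BY NAME** (§1 at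
`Θ := theta13OfNumerics … (stage12NumericsOfThm1CCM F.L jM ε₀ B₃ B₃' a₀ a₁c) …`, whose ₁₃ live re-pin IS `θ₁₅ᶜᶜᴹ(jM)` by `rfl`; K0b's residuals by K0a's `hasResidualsOfRecord_theta13OfNumerics`;
`2 ≤ M₁ = L^{jM}` from `1 ≤ jM`; `ν.εreg = a₀` by `rfl`; (8) := dag-n07-e's bridge at `h8`): the witness's OWN letters `(B₃, a₀)` are the [15] constants — stub 1's `h8 : Prop8RegSepTopStep F 2 suppDom B₃ a₀ a₁'`
(with `0 < B₃`, from stub 1's floor `2L² ≤ B₃`) feeds BOTH K0⁷'s body (dag-n21-c FILE C) AND N12's Proposition-1 row here; the witness's (9)-constant `B₃'` and ceiling slot `a₁c` are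
free (the V15 witness has `jM = 3`, `B₃' = B₉·B₃`, `a₁c = min a₁' (a₀''∕B₃)` — an instance).  ZERO K0-side hypotheses beyond stub 1's letters; what stays displayed per instance: (J1) ∕ (L2)
(NODE 00 ∕ [LF-II] pp.357–359), `hcJ'`, (Gᵃ), `hdiv`, `hZ1`, `hk0` ∕ `hk`, box data, and N12's per-run displays below the torus.  Count-neutral; NOT a discharge of N12; K0⁷ ∕ K1⁷ NOT closed. [cite: Balaban1989LargeFieldI, (0.2)–(0.6) p.176, (1.74) p.192, p.193 ll.14–20, Prop. 1 (1.77)–(1.78) p.194, (1.80) p.195, (1.89) p.198, (1.99)–(1.102) pp.200–201; Balaban1988Convergent, (2.1) p.254, (2.5) p.255, (2.12)–(2.13) pp.256–257, (3.16) p.268, (3.22)–(3.25) pp.269–270; Balaban1985RegularSpaces, (1.3)–(1.6) p.77 (witness letter); Balaban1985Variational, Thm 1 (8) p.279, (152) p.301, Prop. 8 p.304 (bookkeeping)] -/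
theorem exists_pinLF_b15Leaf_WOfRecord₁₃_theta13OfThm1CCM_of_massLive_of_prop8TopStep_atZSeqCoPRecord_geom (hjM : 1 ≤ jM)
    -- N12's displays at the letters `kSel ∕ D189 ∕ D1100` of `λ`, run by run, BELOW THE TORUS
    (hpin : ∀ P : B12.RunParams, lam.kSel P < P.K → lam.D1100 P
      = rPrimeDataOfSel (reprTOfRecord₁₃ F 2 (theta13OfThm1CCM F 2 jM ε₀ ε₂₉ B₃ B₃' a₀ a₁c) P (lam.kSel P))
          ((theta13OfThm1CCM F 2 jM ε₀ ε₂₉ B₃ B₃' a₀ a₁c).ppSel P (gOfRecord₁₃ F 2 (theta13OfThm1CCM F 2 jM ε₀ ε₂₉ B₃ B₃' a₀ a₁c) P) (lam.kSel P + 1))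
          (fibOfSeq F (theta13OfThm1CCM F 2 jM ε₀ ε₂₉ B₃ B₃' a₀ a₁c).ν (theta13OfThm1CCM F 2 jM ε₀ ε₂₉ B₃ B₃' a₀ a₁c).τ9 P (gOfRecord₁₃ F 2 (theta13OfThm1CCM F 2 jM ε₀ ε₂₉ B₃ B₃' a₀ a₁c) P) (lam.kSel P + 1)))
    (hmassLive : ∀ P : B12.RunParams, lam.kSel P < P.K → ∀ s, LiveSeq F 2 (theta13OfThm1CCM F 2 jM ε₀ ε₂₉ B₃ B₃' a₀ a₁c).ν (theta13OfThm1CCM F 2 jM ε₀ ε₂₉ B₃ B₃' a₀ a₁c).τ9 P (gOfRecord₁₃ F 2 (theta13OfThm1CCM F 2 jM ε₀ ε₂₉ B₃ B₃' a₀ a₁c) P) (lam.kSel P + 1)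
        (slotsTOfRecord F 2 (theta13OfThm1CCM F 2 jM ε₀ ε₂₉ B₃ B₃' a₀ a₁c).ν (theta13OfThm1CCM F 2 jM ε₀ ε₂₉ B₃ B₃' a₀ a₁c).τ9 (EOfRecord₁₃ F 2 (theta13OfThm1CCM F 2 jM ε₀ ε₂₉ B₃ B₃' a₀ a₁c)) (wOfRecord₉ F 2 (theta13OfThm1CCM F 2 jM ε₀ ε₂₉ B₃ B₃' a₀ a₁c).toStage9Params)
          (theta13OfThm1CCM F 2 jM ε₀ ε₂₉ B₃ B₃' a₀ a₁c).ppSel P (gOfRecord₁₃ F 2 (theta13OfThm1CCM F 2 jM ε₀ ε₂₉ B₃ B₃' a₀ a₁c) P) (lam.kSel P + 1)) s →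
      0 < ∫ V, rterm (reprTOfRecord₁₃ F 2 (theta13OfThm1CCM F 2 jM ε₀ ε₂₉ B₃ B₃' a₀ a₁c) P (lam.kSel P)) s V ∂(fieldMeasure (F.P P.K) (lam.kSel P + 1) (SU 2)))
    (h180 : ∀ P : B12.RunParams, lam.kSel P < P.K → ∀ U, new189 (lam.D189 P) U → ∀ i, (lam.D189 P).h ≤ i → i ≤ (lam.D189 P).k →
      ∀ q ∈ plaqsOf (dom (lam.D189 P) i),
        Ineq180 ((lam.D189 P).dev0 U q) ((lam.D189 P).ε (lam.D189 P).k) (lam.D189 P).η (lam.D189 P).B₃ (lam.D189 P).B₅ (lam.D189 P).M (lam.D189 P).δ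
          ((lam.D189 P).dist q) (lam.D189 P).O1)
    (h189 : ∀ P : B12.RunParams, lam.kSel P < P.K → Claim189 (new189 (lam.D189 P)) (chiPP (lam.D189 P)))
    -- dag-n12-c's Proposition-1 instance data ON THE RUN's LATTICE `F.P P.K`, per run `P` and instance `i : ι P` (structural ∕ constants, exactly as in its endpoint of record)
    (hd3 : ∀ P : B12.RunParams, 3 ≤ (F.P P.K).d) (h0 : ∀ P : B12.RunParams, 0 < (F.P P.K).d) (ι : B12.RunParams → Type)
    -- NO background letters: per instance the class is that of `Z P i`'s OWN maximal sequence `maxDomT (theta13OfThm1CCM F 2 jM ε₀ ε₂₉ B₃ B₃' a₀ a₁c).ν.M₁ (Z P i)` up to scale `k P i` (dag-n12-c LOCATED-CLASS)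
    (Z Λ : ∀ P : B12.RunParams, ι P → Set (Site (F.P P.K) 0))
    (k : ∀ P : B12.RunParams, ι P → ℕ) (M : ∀ P : B12.RunParams, ι P → ℝ) (hk0 : ∀ P i, 0 < k P i) (hk : ∀ P i, k P i ≤ (F.P P.K).m + (F.P P.K).K)
    (eR : ∀ P : B12.RunParams, ι P → ℝ) (heR : ∀ P i, 0 < eR P i)
    (T : ∀ (P : B12.RunParams) (i : ι P), Finset (PBond (F.P P.K) (k P i)))
    (lo hi : ∀ P : B12.RunParams, ι P → Fin (F.P P.K).d → ℤ) (n : ∀ P : B12.RunParams, ι P → ℕ) (hn : ∀ P i κ, hi P i κ ≤ lo P i κ + n P i)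
    (hN : ∀ P i, n P i + 2 < (F.P P.K).sitesPerDir (k P i))
    (hbox : ∀ P i, pts (k P i) (Λ P i) = (castSite '' Set.Icc (lo P i) (hi P i) : Set (Site (F.P P.K) (k P i))))
    (hZ : ∀ P i, (boxPlaqs (lo P i - 1) (hi P i + 1) : Set (Plaq (F.P P.K) (k P i))) ⊆ plaqsInside (pts (k P i) (Z P i)))
    (hTG0 : ∀ P i, T P i = (box (fun κ => (hi P i κ - lo P i κ + 1).toNat) (lo P i)).image fun x =>
      (⟨castSite (x - unitVec ⟨0, h0 P⟩), ⟨0, h0 P⟩⟩ : PBond (F.P P.K) (k P i)))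
    (hN5 : ∀ P i κ, ((hi P i κ - lo P i κ + 1).toNat : ℤ) + 5 < (F.P P.K).sitesPerDir (k P i))
    (Kb : ∀ P : B12.RunParams, ι P → ℕ) (hK1 : ∀ P i, 1 ≤ Kb P i) (hKn : ∀ P i κ, (hi P i κ - lo P i κ + 1).toNat ≤ Kb P i)
    (ext : ∀ (P : B12.RunParams) (i : ι P), GaugeField (F.P P.K) (k P i) SU2 → GaugeField (F.P P.K) (k P i) SU2)
    (hext : ∀ P i Vk, ext P i Vk = extend (pts (k P i) (Λ P i)) (shellGauge Vk (lo P i) (hi P i)) Vk)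
    (hlohi : ∀ P i, lo P i ≤ hi P i)
    {γ cJ bx : B12.RunParams → ℝ} (hγ : ∀ P, 0 < γ P) (hcJ : ∀ P, 0 ≤ cJ P) (hbx : ∀ P, 0 ≤ bx P)
    (hbxM : ∀ P i, 12 * ((F.P P.K).d : ℝ) * ((n P i : ℝ) + 2) ^ 2 ≤ bx P * (M P i) ^ 2)
    {Cerr R 𝓐 : ∀ P : B12.RunParams, ι P → ℝ} (hM : ∀ P i, 1 ≤ M P i) (hR : ∀ P i, 0 < R P i) (h𝓐 : ∀ P i, 0 ≤ 𝓐 P i)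
    (n' : ∀ P : B12.RunParams, ι P → ℕ) (hn' : ∀ P i, 1 ≤ n' P i)
    -- (J1) the JOINT holomorphic extension of print's function in the datum perturbation and the field
    (hGj : ∀ P i Vk, PlaqSmallOn (plaqsInside (pts (k P i) (Z P i ∩ (Λ P i)ᶜ))) (eR P i) Vk →
      ∃ 𝒢 : VecField (F.P P.K) (k P i) (EuclideanSpace ℂ (Fin 3)) × VecField (F.P P.K) (k P i) (EuclideanSpace ℂ (Fin 3)) → ℂ,
        DifferentiableOn ℂ 𝒢 (ball 0 (R P i)) ∧
        (∀ z ∈ ball (0 : VecField (F.P P.K) (k P i) (EuclideanSpace ℂ (Fin 3)) × VecField (F.P P.K) (k P i) (EuclideanSpace ℂ (Fin 3))) (R P i), ‖𝒢 z‖ ≤ 𝓐 P i) ∧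
        ∀ p B' : VecField (F.P P.K) (k P i) E3, ‖p‖ < R P i → ‖B'‖ < R P i →
          𝒢 (cplxVec p, cplxVec B') =
            ((fun177std (bgMSCoPOfRecord F 2 (theta13OfThm1CCM F 2 jM ε₀ ε₂₉ B₃ B₃' a₀ a₁c).ν P.K (k P i) (maxDomT (theta13OfThm1CCM F 2 jM ε₀ ε₂₉ B₃ B₃' a₀ a₁c).ν.M₁ (Z P i))) (theta13OfThm1CCM F 2 jM ε₀ ε₂₉ B₃ B₃' a₀ a₁c).ν.M₁ (Z P i) (k P i) (expMul su2Chart B' (ext P i (expMul su2Chart p Vk))) : ℝ) : ℂ))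
    -- (L2) (1.7)–(1.9) p.358 for the Hessian of the slice function at `0`
    (hlead : ∀ P i Vk, PlaqSmallOn (plaqsInside (pts (k P i) (Z P i ∩ (Λ P i)ᶜ))) (eR P i) Vk →
      ∀ X : GaugeSlice (pts (k P i) (Λ P i)) (T P i) E3,
      |⟪X, (fderiv ℝ (rGrad (pts (k P i) (Λ P i)) (T P i)
              (sliceFn (pts (k P i) (Λ P i)) (T P i) (fun177std (bgMSCoPOfRecord F 2 (theta13OfThm1CCM F 2 jM ε₀ ε₂₉ B₃ B₃' a₀ a₁c).ν P.K (k P i) (maxDomT (theta13OfThm1CCM F 2 jM ε₀ ε₂₉ B₃ B₃' a₀ a₁c).ν.M₁ (Z P i))) (theta13OfThm1CCM F 2 jM ε₀ ε₂₉ B₃ B₃' a₀ a₁c).ν.M₁ (Z P i) (k P i)) (ext P i Vk))) 0) X⟫ -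
          ∑ a : Fin 3, formDk (n' P i) (fun _ : Fin (F.P P.K).d => (F.P P.K).sitesPerDir (k P i))
            (ofRealCfg (fun _ : Fin (F.P P.K).d => (F.P P.K).sitesPerDir (k P i)) fun j =>
              ιA (pts (k P i) (Λ P i)) (T P i) X ⟨j.1, j.2⟩ a)| ≤ Cerr P i * ‖X‖ ^ 2)
    (hsm : ∀ P i, Cerr P i ≤ (4 / Real.pi ^ 2) ^ ((F.P P.K).d + 2) / (2 * (3 * (Kb P i : ℝ) ^ 2 + 2 * (Kb P i : ℝ) ^ 4)))
    (hγle : ∀ P i, γ P / (M P i) ^ 5 ≤ (4 / Real.pi ^ 2) ^ ((F.P P.K).d + 2) / (2 * (3 * (Kb P i : ℝ) ^ 2 + 2 * (Kb P i : ℝ) ^ 4)))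
    -- the geometric letter: every fine site whose k-block label lies in the box `[lo − 1, hi + 1]` lies in `Ω₁(Z)` (print: `Λ` deep inside `Z`); dag-n12-c's `far_letter_of_box` turns it into the bond letter `hfar`
    (hZ1 : ∀ P i (y : Site (F.P P.K) 0), B14.Eq22Determines.blockIter (k P i) y ∈ (castSite '' Set.Icc (lo P i - 1) (hi P i + 1) : Set (Site (F.P P.K) (k P i))) → y ∈ maxDomT (theta13OfThm1CCM F 2 jM ε₀ ε₂₉ B₃ B₃' a₀ a₁c).ν.M₁ (Z P i) 1)
    -- (Gᵃ) `Z` a union of `k`-blocks (print's `Z` is a union of `M`-cubes of `T₁^{(k)}`)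
    (hZblk : ∀ P i, B14.Eq22Determines.IsBlockUnion (k P i) (Z P i))
    -- (Gᵇ) DISCHARGED (dag-n12-c §8): print's `M₁ ≥ 2` and, per instance, the torus divisibility `L^{k}·M₁ ∣ 2L^{m+K}` of the `LʲM₁`-cube partitions
    (hdiv : ∀ P i, B14.Eq213MaximalDomains.side (F.P P.K).L (theta13OfThm1CCM F 2 jM ε₀ ε₂₉ B₃ B₃' a₀ a₁c).ν.M₁ (k P i) ∣ (F.P P.K).sitesPerDir 0)
    -- bookkeeping constants: `c_E`, `c_A` per run; `B₃`, `a₀`, `a₁'` = THE [15] THEOREM-1 CONSTANTS OF (8) (one triple for all runs and instances)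
    {cE cA : B12.RunParams → ℝ} (hcE0 : ∀ P, 0 ≤ cE P) (hcE : ∀ P i, 12 * ((F.P P.K).d : ℝ) * ((n P i : ℝ) + 2) ^ 2 ≤ cE P)
    (heRa : ∀ P i, (cE P + 1) * eR P i ≤ a₁' ∧ B₃ * ((cE P + 1) * eR P i) ≤ (theta13OfThm1CCM F 2 jM ε₀ ε₂₉ B₃ B₃' a₀ a₁c).ν.εreg)
    (hcA : ∀ P, 1 / 2 * (B₃ * (cE P + 1) * (F.P P.K).eta 1 ^ 2) ^ 2 * (Fintype.card (Plaq (F.P P.K) 0) : ℝ) ≤ cA P)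
    -- plan g76 V15 stub 1 `stub_prop8StepCoP13`'s letters: [15] Prop. 8's top step at NODE 00's objects — its `(B₃, a₀, a₁')` ARE the [15] constants of the bookkeeping above,
    -- and `a₀` is the witness's `εreg` (`rfl`); `0 < B₃` from stub 1's floor `2L² ≤ B₃`
    (hB₃pos : 0 < B₃) (h8 : Prop8RegSepTopStep F 2 (fun ν K Ω => suppDomOfRecord F ν K Ω) B₃ a₀ a₁')
    (hcJ' : ∀ P i, 2 * cA P * eR P i / R P i + 4 * 𝓐 P i / (R P i * eR P i) ≤ cJ P) :
    ∃ areg : ∀ P : B12.RunParams, ι P → ℝ, (∀ P i, 0 < areg P i) ∧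
      ∀ P : B12.RunParams, lam.kSel P < P.K →
        B15Leaf (WOfRecord₁₃ F 2 (theta13OfThm1CCM F 2 jM ε₀ ε₂₉ B₃ B₃' a₀ a₁c)
          { lam with LF := fun P => lfVarOn su2Chart fun i => InstOn.std (bgMSCoPOfRecord F 2 (theta13OfThm1CCM F 2 jM ε₀ ε₂₉ B₃ B₃' a₀ a₁c).ν P.K (k P i) (maxDomT (theta13OfThm1CCM F 2 jM ε₀ ε₂₉ B₃ B₃' a₀ a₁c).ν.M₁ (Z P i))) (theta13OfThm1CCM F 2 jM ε₀ ε₂₉ B₃ B₃' a₀ a₁c).ν.M₁ (Z P i) (Λ P i) (k P i) (M P i) (areg P i)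
                            (anExt (pts (k P i) (Λ P i)) (T P i) (fun177std (bgMSCoPOfRecord F 2 (theta13OfThm1CCM F 2 jM ε₀ ε₂₉ B₃ B₃' a₀ a₁c).ν P.K (k P i) (maxDomT (theta13OfThm1CCM F 2 jM ε₀ ε₂₉ B₃ B₃' a₀ a₁c).ν.M₁ (Z P i))) (theta13OfThm1CCM F 2 jM ε₀ ε₂₉ B₃ B₃' a₀ a₁c).ν.M₁ (Z P i) (k P i)) (ext P i)
                              (min (1 / 2) (min (R P i / 8) (γ P / (M P i) ^ 5 * (R P i / 2) ^ 2 / (48 * (4 * 𝓐 P i / R P i + 1)))))) } P) := by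
  -- `2 ≤ M₁ = L^{jM}` at the collared witness (`1 ≤ jM`, `1 < L`; dag-n21-c's `theta13OfThm1CCM_M₁`, `rfl`); `εreg = a₀` (`rfl`)
  have h2 : 2 ≤ F.L ^ jM :=
    calc 2 ≤ F.L := F.hL.2
      _ = F.L ^ 1 := (pow_one _).symm
      _ ≤ F.L ^ jM := Nat.pow_le_pow_right (Nat.zero_lt_of_lt F.hL.2) hjM
  exact exists_pinLF_b15Leaf_WOfRecord₁₃_liveRepin₁₃_of_massLive_of_hasResiduals_of_variationalThm1RegSepCoP7M_atZSeqCoPRecord_geom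
    (theta13OfNumerics F 2 (stage12NumericsOfThm1CCM F.L jM ε₀ B₃ B₃' a₀ a₁c) ε₂₉ (zeta316OfRecord F 2 (stage12NumericsOfThm1CCM F.L jM ε₀ B₃ B₃' a₀ a₁c).ν (stage12NumericsOfThm1CCM F.L jM ε₀ B₃ B₃' a₀ a₁c).τ9.M (stage12NumericsOfThm1CCM F.L jM ε₀ B₃ B₃' a₀ a₁c).A₁) (RzOfRecord F 2) (ZtOfRecord F 2)) lam
    (hasResidualsOfRecord_theta13OfNumerics F 2 (stage12NumericsOfThm1CCM F.L jM ε₀ B₃ B₃' a₀ a₁c) ε₂₉) (hM2 := h2) (hB₃ := hB₃pos.le) (ha₀ := le_of_eq rfl)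
    (h15 := variationalThm1RegSepCoP7M_of_prop8TopStep hB₃pos h8)
    (hpin := hpin) (hmassLive := hmassLive) (h180 := h180) (h189 := h189) (hd3 := hd3) (h0 := h0) (ι := ι) (Z := Z) (Λ := Λ)
    (k := k) (M := M) (hk0 := hk0) (hk := hk) (eR := eR) (heR := heR) (T := T) (lo := lo) (hi := hi)
    (n := n) (hn := hn) (hN := hN) (hbox := hbox) (hZ := hZ) (hTG0 := hTG0) (hN5 := hN5) (Kb := Kb) (hK1 := hK1)
    (hKn := hKn) (ext := ext) (hext := hext) (hlohi := hlohi) (hγ := hγ) (hcJ := hcJ) (hbx := hbx) (hbxM := hbxM) (hM := hM)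
    (hR := hR) (h𝓐 := h𝓐) (n' := n') (hn' := hn') (hGj := hGj) (hlead := hlead) (hsm := hsm) (hγle := hγle) (hZ1 := hZ1)
    (hZblk := hZblk) (hdiv := hdiv) (hcE0 := hcE0) (hcE := hcE) (heRa := heRa) (hcA := hcA) (hcJ' := hcJ')

end AtThm1CCM

end Summit.QuantumFields.YangMills.BalabanUVNodes.N12AtRecord13Prop1KnitThm1OfRecord
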